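import Literature.Analysis.FluidPDE.CLStressEstimates
import Literature.Analysis.FluidPDE.CLEnergyEstimate
import Literature.Analysis.FluidPDE.NavierStokesReynoldsSteps
import HarnessLib

/-!
# Proof of the convex-integration step of Cheskidov–Luo (CL22 Prop. 4.1), with the parameter choice of §5.1

Analysis/FluidPDE proof file: the named fact `Torus.CheskidovLuo2022ConvexIntegration`
(`NavierStokesReynoldsSteps`; A. Cheskidov, X. Luo, *Sharp nonuniqueness for the Navier–Stokes
equations*, Invent. Math. 229 (2022) = arXiv:2009.06596, Prop. 4.1) is PROVED
(`Torus.CheskidovLuo2022ConvexIntegration_holds`), assembling §§4–5 of the paper as formalised in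
this series:

* §4 (construction): the datum `CL22.Datum` with the time cut-off `θ` of (4.14)
  (`CL22.exists_timeCutoff`), one disjointly supported unit bump per direction
  (`Intermittent.exists_isBump_disjoint`), floor `γ₀ = ‖R‖_{L¹_{t,x}}/T` of the divisor, and the
  parameters of §5.1 (Part 1 of this file: `ν = λ^γ`, `κ = λ^{2/γ+d+1-6γ}`, `μ = λ`, `σ = ⌈λ^{1/γ}⌉`,
  `γ = (1/p - 1/2)/(2d)`, `r = (d-1)/(d-1-γ)`); the perturbation `w = w^{(p)} + w^{(c)} + w^{(t)}`
  (`CLPerturbation`), the stress algebra (`CLStressAlgebra.momentum_identity`, Lemma 4.5) and the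
  perturbed triple (`Torus.IsNSReynoldsOn.perturb`, Lemma 4.6);
* §5 (estimates): `CLDataBounds` (the constants `C_u`), `CLVelocityEstimates` (Props. 5.3–5.5,
  sup parts), `CLEnergyEstimate` (Prop. 5.3, `L²`), `CLStressPointwise` / `CLStressEstimates`
  (Lemmas 5.6–5.8), Part 1 of this file (Lemma 5.1), and the choice of `λ` large ("for all sufficiently
  large `λ`": six explicit smallness conditions on `λ^{-γ}`).

The universal constant is `M = (2d²/r_d + d + 2d/r_d + 1)^{1/2} + 2` (`r_d = 1/(5(d-1))`), the
exponent `r` depends on `p` and `d`, and when `R ≡ 0` on `[0,T]` the step is the identity. The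
well-preparedness of `R₁` for the SAME `(I, τ)` is Lemma 4.6 (`w = S₁ = ff = 0` where
`θ = θ' = 0`, i.e. where `dist(t, Iᶜ) ≤ τ`), the support clause is `θ = 0` off `I`.

## Part 1 — the choice of parameters (CL22 §5.1, Lemma 5.1)

All results proved. CL22 §5.1 (numbering of the held arXiv copy): "Let `λ` be a sufficiently large number
whose value will be fixed in the end. We choose the parameters `σ, κ` along with `ν, μ` … as explicit
powers of `λ`: `ν = ⌈λ^γ⌉`, `σ = ⌈λ^{1/γ}⌉`, `κ = λ^{2/γ+d+1-6γ}`, `μ = λ`", and Lemma 5.1: the three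
products (5.2)–(5.4) are `≤ λ^{-γ}`.

For a datum `D : CL22.Datum d` we define the one-parameter family
`D.atScale γ lam = D.withParams (lam^γ) (lam^{k(γ)}) lam ⌈lam^{1/γ}⌉₊`, `k(γ) = 2/γ + d + 1 - 6γ`
(`ν` need not be an integer in this rendering), and PROVE, for `lam ≥ 1`, `0 < γ ≤ 1/(4d)` and the
exponent `r(γ) = (d-1)/(d-1-γ)` (so that `(d-1)/r = d-1-γ`, i.e. `d - 1 - (d-1)/r = γ`, the
equality case of CL22 (5.1b) `d - d/r ≤ γ`):

* `small_atScale_le` — the six monomials of `Datum.small` (`CLStressEstimates`) are each `≤ 2lam^{-γ}`,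
  so `𝔰 ≤ 12 lam^{-γ}` (this contains (5.2): `νκ^{1/2}σ⁻¹μ⁻¹μ^{(d-1)/2-(d-1)/r} ≤ λ^{-γ}` and (5.4)
  with `q = r`);
* `profile_rpow_le` — the bookkeeping `((T+1)κ^{q/2-1}A^q)^{1/q} ≤ (T+1)Aκ^{1/2-1/q}` behind (5.3): `μ^{(d-1)/2} ((T+1)κ^{p/2-1}A^p)^{1/p} ≤ (T+1)A lam^{-γ}` when
  `γ = (1/p - 1/2)/(2d)` ("`10dγ ≤ 1/p - 1/2`", (5.1a)), the `L^p_tL^∞_x` size of `w^{(p)}`;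
* `sigma_le`, `inv_sigma_le`, `inv_sigma_sq_le` — `λ^{1/γ} ≤ σ ≤ 2λ^{1/γ}` for the integer
  `σ = ⌈λ^{1/γ}⌉`;

together with the transfer of validity and of the parameter-free bounds along the family
(`Valid.withParams`, `DataBounds.withParams`).

## References

* A. Cheskidov, X. Luo, arXiv:2009.06596, Prop. 4.1, §4.3 (4.14), §4.4–4.5 Lemmas 4.4–4.6, §5
  Lemma 5.1, Props. 5.3–5.5, Lemmas 5.6–5.8. [`CheskidovLuo2022`]
-/

noncomputable section

open Set Filter Topology Function MeasureTheory Finset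
open scoped ContDiff ENNReal

namespace Literature.Analysis.FluidPDE

namespace CL22

open FunctionSpaces NashGeometric Mikado Intermittent

variable {d : Type*} [Fintype d] [DecidableEq d]

/-! ## Exponents -/

/-- The exponent of the temporal concentration, `k(γ) = 2/γ + d + 1 - 6γ` (CL22 §5.1:
`κ = λ^{2/γ+d+1-6γ}`). [cite: CheskidovLuo2022, §5.1] -/
def kOfGamma (γ : ℝ) (dd : ℝ) : ℝ := 2 / γ + dd + 1 - 6 * γ

/-- The Lebesgue exponent `r(γ) = (d-1)/(d-1-γ)` of the new stress, so that `(d-1)/r = d-1-γ`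
(the equality case of CL22 (5.1b)). [cite: CheskidovLuo2022, §5.1 (5.1b)] -/
def rOfGamma (γ : ℝ) (dd : ℝ) : ℝ := (dd - 1) / (dd - 1 - γ)

/-- `1 < r(γ)` for `0 < γ < d - 1`. [folklore] -/
theorem one_lt_rOfGamma {γ dd : ℝ} (hγ : 0 < γ) (hγd : γ < dd - 1) : 1 < rOfGamma γ dd := by
  rw [rOfGamma, one_lt_div (by linarith)]; linarith

/-- `r(γ) ≤ 2` for `2γ ≤ d - 1`. [folklore] -/
theorem rOfGamma_le_two {γ dd : ℝ} (hγ : 0 < γ) (hγd : 2 * γ ≤ dd - 1) : rOfGamma γ dd ≤ 2 := by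
  rw [rOfGamma, div_le_iff₀ (by linarith)]; linarith

/-- `(d-1)/r(γ) = d-1-γ`. [folklore] -/
theorem er_rOfGamma {γ dd : ℝ} (hγ : 0 < γ) (hγd : γ < dd - 1) : (dd - 1) / rOfGamma γ dd = dd - 1 - γ := by
  have h1 : dd - 1 ≠ 0 := by linarith
  have h2 : dd - 1 - γ ≠ 0 := by linarith
  rw [rOfGamma]
  field_simp

/-! ## The family of data -/

namespace Datum

variable (D : Datum d)

/-- The same data with other parameters. [folklore] -/
def withParams (ν κ μ : ℝ) (σ : ℕ) : Datum d := ⟨D.T, D.γ₀, D.R, D.θ, D.g, ν, κ, μ, σ⟩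

/-- **The one-parameter family of CL22 §5.1**: `ν = lam^γ`, `κ = lam^{k(γ)}`, `μ = lam`,
`σ = ⌈lam^{1/γ}⌉`. [cite: CheskidovLuo2022, §5.1] -/
def atScale (γ lam : ℝ) : Datum d :=
  D.withParams (lam ^ γ) (lam ^ kOfGamma γ (Fintype.card d)) lam ⌈lam ^ (1 / γ)⌉₊

omit [Fintype d] [DecidableEq d] in
/-- The field `T` along `withParams` (definitional). [folklore] -/
@[simp] theorem withParams_T (ν κ μ : ℝ) (σ : ℕ) : (D.withParams ν κ μ σ).T = D.T := rfl
omit [Fintype d] [DecidableEq d] in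
/-- The field `γ₀` along `withParams` (definitional). [folklore] -/
@[simp] theorem withParams_γ₀ (ν κ μ : ℝ) (σ : ℕ) : (D.withParams ν κ μ σ).γ₀ = D.γ₀ := rfl
omit [Fintype d] [DecidableEq d] in
/-- The field `R` along `withParams` (definitional). [folklore] -/
@[simp] theorem withParams_R (ν κ μ : ℝ) (σ : ℕ) : (D.withParams ν κ μ σ).R = D.R := rfl
omit [Fintype d] [DecidableEq d] in
/-- The field `θ` along `withParams` (definitional). [folklore] -/
@[simp] theorem withParams_θ (ν κ μ : ℝ) (σ : ℕ) : (D.withParams ν κ μ σ).θ = D.θ := rfl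
omit [Fintype d] [DecidableEq d] in
/-- The field `g` along `withParams` (definitional). [folklore] -/
@[simp] theorem withParams_g (ν κ μ : ℝ) (σ : ℕ) : (D.withParams ν κ μ σ).g = D.g := rfl
omit [Fintype d] [DecidableEq d] in
/-- The field `ν` along `withParams` (definitional). [folklore] -/
@[simp] theorem withParams_ν (ν κ μ : ℝ) (σ : ℕ) : (D.withParams ν κ μ σ).ν = ν := rfl
omit [Fintype d] [DecidableEq d] in
/-- The field `κ` along `withParams` (definitional). [folklore] -/
@[simp] theorem withParams_κ (ν κ μ : ℝ) (σ : ℕ) : (D.withParams ν κ μ σ).κ = κ := rfl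
omit [Fintype d] [DecidableEq d] in
/-- The field `μ` along `withParams` (definitional). [folklore] -/
@[simp] theorem withParams_μ (ν κ μ : ℝ) (σ : ℕ) : (D.withParams ν κ μ σ).μ = μ := rfl
omit [Fintype d] [DecidableEq d] in
/-- The field `σ` along `withParams` (definitional). [folklore] -/
@[simp] theorem withParams_σ (ν κ μ : ℝ) (σ : ℕ) : (D.withParams ν κ μ σ).σ = σ := rfl
omit [DecidableEq d] in
/-- The field `T` along `atScale` (definitional). [folklore] -/
@[simp] theorem atScale_T (γ lam : ℝ) : (D.atScale γ lam).T = D.T := rfl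
omit [DecidableEq d] in
/-- The field `R` along `atScale` (definitional). [folklore] -/
@[simp] theorem atScale_R (γ lam : ℝ) : (D.atScale γ lam).R = D.R := rfl
omit [DecidableEq d] in
/-- The field `θ` along `atScale` (definitional). [folklore] -/
@[simp] theorem atScale_θ (γ lam : ℝ) : (D.atScale γ lam).θ = D.θ := rfl
omit [DecidableEq d] in
/-- The field `γ₀` along `atScale` (definitional). [folklore] -/
@[simp] theorem atScale_γ₀ (γ lam : ℝ) : (D.atScale γ lam).γ₀ = D.γ₀ := rfl
omit [DecidableEq d] in
/-- The field `ν` along `atScale` (definitional). [folklore] -/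
@[simp] theorem atScale_ν (γ lam : ℝ) : (D.atScale γ lam).ν = lam ^ γ := rfl
omit [DecidableEq d] in
/-- The field `κ` along `atScale` (definitional). [folklore] -/
@[simp] theorem atScale_κ (γ lam : ℝ) : (D.atScale γ lam).κ = lam ^ kOfGamma γ (Fintype.card d) := rfl
omit [DecidableEq d] in
/-- The field `μ` along `atScale` (definitional). [folklore] -/
@[simp] theorem atScale_μ (γ lam : ℝ) : (D.atScale γ lam).μ = lam := rfl
omit [DecidableEq d] in
/-- The field `σ` along `atScale` (definitional). [folklore] -/
@[simp] theorem atScale_σ (γ lam : ℝ) : (D.atScale γ lam).σ = ⌈lam ^ (1 / γ)⌉₊ := rfl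

/-- The perturbation objects that do not involve the parameters are unchanged along the family
(definitional). [folklore] -/
theorem withParams_atil (ν κ μ : ℝ) (σ : ℕ) : (D.withParams ν κ μ σ).atil = D.atil := rfl

variable {D}

omit [DecidableEq d] in
/-- Validity along the family. [folklore] -/
theorem Valid.withParams (h : D.Valid) {ν κ μ : ℝ} {σ : ℕ} (hν : 1 ≤ ν) (hκ : 1 ≤ κ) (hμ : 1 ≤ μ) (hσ : 0 < σ) :
    (D.withParams ν κ μ σ).Valid :=
  ⟨h.hd, h.hT, h.hγ, h.hR, h.hRsym, h.hθ, h.hθ01, h.hg, h.hg1, h.hgg, hν, hκ, hμ, hσ⟩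

/-- The parameter-free bounds transfer along the family. [folklore] -/
theorem DataBounds.withParams {A : ℝ} (hA : D.DataBounds A) (ν κ μ : ℝ) (σ : ℕ) : (D.withParams ν κ μ σ).DataBounds A :=
  ⟨hA.nonneg, hA.g_le, hA.dg_le, hA.dθ_le, hA.atil_le, hA.gradA_le, hA.dgradA_le, hA.dtatil_le, hA.dtgradA_le,
    hA.lap_atilSq_le, hA.dt_atilSq_le, hA.dirD_atil_le, hA.d_dirD_atil_le, hA.dirD_atilSq_le, hA.d_dirD_atilSq_le,
    hA.Z_le, hA.dZ_le, hA.dtZ_le⟩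

/-! ## Elementary facts on the scale -/

section Scale

variable {γ lam : ℝ}

omit [Fintype d] [DecidableEq d] in
/-- `σ ≤ 2 lam^{1/γ}` (`lam ≥ 1`, `γ > 0`). [folklore] -/
theorem sigma_le (hγ : 0 < γ) (hlam : 1 ≤ lam) : (⌈lam ^ (1 / γ)⌉₊ : ℝ) ≤ 2 * lam ^ (1 / γ) := by
  have h1 : (1 : ℝ) ≤ lam ^ (1 / γ) := Real.one_le_rpow hlam (by positivity)
  have h2 := (Nat.ceil_lt_add_one (by positivity : (0 : ℝ) ≤ lam ^ (1 / γ))).le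
  linarith

omit [Fintype d] [DecidableEq d] in
/-- `0 < σ` (`lam ≥ 1`). [folklore] -/
theorem sigma_pos (hlam : 1 ≤ lam) : 0 < ⌈lam ^ (1 / γ)⌉₊ :=
  Nat.ceil_pos.2 (Real.rpow_pos_of_pos (by linarith) _)

omit [Fintype d] [DecidableEq d] in
/-- `σ⁻¹ ≤ lam^{-1/γ}` (`lam ≥ 1`). [folklore] -/
theorem inv_sigma_le (hlam : 1 ≤ lam) : ((⌈lam ^ (1 / γ)⌉₊ : ℕ) : ℝ)⁻¹ ≤ lam ^ (-(1 / γ)) := by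
  have hl : 0 < lam := by linarith
  have h1 : 0 < lam ^ (1 / γ) := Real.rpow_pos_of_pos hl _
  rw [Real.rpow_neg hl.le]
  exact inv_anti₀ h1 (Nat.le_ceil _)

omit [Fintype d] [DecidableEq d] in
/-- `σ⁻² ≤ lam^{-2/γ}` (`lam ≥ 1`). [folklore] -/
theorem inv_sigma_sq_le (hlam : 1 ≤ lam) : (((⌈lam ^ (1 / γ)⌉₊ : ℕ) : ℝ) ^ 2)⁻¹ ≤ lam ^ (-(2 / γ)) := by
  have hl : 0 < lam := by linarith
  have h0 : 0 ≤ ((⌈lam ^ (1 / γ)⌉₊ : ℕ) : ℝ)⁻¹ := by positivity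
  have h1 := inv_sigma_le (γ := γ) hlam
  have e : lam ^ (-(2 / γ)) = lam ^ (-(1 / γ)) * lam ^ (-(1 / γ)) := by rw [← Real.rpow_add hl]; ring_nf
  rw [e, ← inv_pow, sq]
  exact mul_le_mul h1 h1 h0 (Real.rpow_nonneg hl.le _)

end Scale

/-! ## The six monomials along the family -/

section Small

variable {D : Datum d} (h : D.Valid) {γ lam : ℝ} (hγ : 0 < γ) (hγd : γ ≤ 1 / (4 * (Fintype.card d : ℝ)))

include h hγ hγd in
omit [DecidableEq d] in
/-- Consequences of `0 < γ ≤ 1/(4d)`, `d ≥ 2`: `γ ≤ 1/8`, `4d ≤ 1/γ`, `γ < d - 1`. [folklore] -/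
theorem gamma_facts : γ ≤ 1 / 8 ∧ 4 * (Fintype.card d : ℝ) ≤ 1 / γ ∧ γ < (Fintype.card d : ℝ) - 1 ∧ 2 * γ ≤ (Fintype.card d : ℝ) - 1 := by
  have hd : (2 : ℝ) ≤ Fintype.card d := by exact_mod_cast h.hd
  have hd0 : (0 : ℝ) < 4 * (Fintype.card d : ℝ) := by linarith
  have h1 : γ * (4 * (Fintype.card d : ℝ)) ≤ 1 := by rwa [le_div_iff₀ hd0] at hγd
  refine ⟨?_, ?_, ?_, ?_⟩
  · rw [le_div_iff₀ (by norm_num : (0 : ℝ) < 8)]; nlinarith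
  · rw [le_div_iff₀ hγ]; linarith
  · nlinarith
  · nlinarith

include h hγ hγd in
omit [DecidableEq d] in
/-- **The six monomials are `≤ 2 lam^{-γ}` each, hence `𝔰 ≤ 12 lam^{-γ}`** along the family with
`r = r(γ)` (CL22 Lemma 5.1 (5.2), (5.4) and the sizes `ν⁻¹`, `σ⁻¹μ^{d-1}`, `κ^{-1/2}μ^{(d-1)/2}`,
`νκ^{1/2}σ⁻²μ⁻²`). [cite: CheskidovLuo2022, §5.1 Lemma 5.1] -/
theorem small_atScale_le (hlam : 1 ≤ lam) : (D.atScale γ lam).small (rOfGamma γ (Fintype.card d)) ≤ 12 * lam ^ (-γ) := by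
  obtain ⟨hγ8, hγ4, hγd1, hγ2⟩ := gamma_facts h hγ hγd
  have hl : 0 < lam := by linarith
  have hl0 := hl.le
  set dd : ℝ := (Fintype.card d : ℝ) with hdd
  have hd2 : (2 : ℝ) ≤ dd := by rw [hdd]; exact_mod_cast h.hd
  set k : ℝ := kOfGamma γ dd with hk
  have her : (dd - 1) / rOfGamma γ dd = dd - 1 - γ := er_rOfGamma hγ hγd1
  have ha : aexp d = (dd - 1) / 2 := by rw [aexp]
  -- the parameters of the family
  have eν : (D.atScale γ lam).ν = lam ^ γ := rfl
  have eκ : (D.atScale γ lam).κ = lam ^ k := rfl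
  have eμ : (D.atScale γ lam).μ = lam := rfl
  have eσ : (D.atScale γ lam).σ = ⌈lam ^ (1 / γ)⌉₊ := rfl
  have hσinv := inv_sigma_le (γ := γ) hlam
  have hσinv2 := inv_sigma_sq_le (γ := γ) hlam
  have hσle := sigma_le hγ hlam
  have hσ0 : (0 : ℝ) ≤ ((⌈lam ^ (1 / γ)⌉₊ : ℕ) : ℝ)⁻¹ := by positivity
  -- rpow bookkeeping
  have pw : ∀ a b : ℝ, lam ^ a * lam ^ b = lam ^ (a + b) := fun a b => (Real.rpow_add hl a b).symm
  have pκ : ∀ s : ℝ, (lam ^ k) ^ s = lam ^ (k * s) := fun s => (Real.rpow_mul hl0 k s).symm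
  have mono : ∀ {a b : ℝ}, a ≤ b → lam ^ a ≤ lam ^ b := fun hab => Real.rpow_le_rpow_of_exponent_le hlam hab
  have nn : ∀ a : ℝ, 0 ≤ lam ^ a := fun a => Real.rpow_nonneg hl0 a
  have hk2 : k * (1 / 2 : ℝ) = 1 / γ + (dd + 1) / 2 - 3 * γ := by rw [hk, kOfGamma]; ring
  have hk2' : k * (-(1 / 2 : ℝ)) = -(1 / γ + (dd + 1) / 2 - 3 * γ) := by rw [hk, kOfGamma]; ring
  -- exponent inequalities
  have c5 : γ + (1 / γ + (dd + 1) / 2 - 3 * γ) + -(2 / γ) + (-2 : ℝ) ≤ -γ := by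
    have e : γ + (1 / γ + (dd + 1) / 2 - 3 * γ) + -(2 / γ) + (-2 : ℝ) = -(1 / γ) - 2 * γ + (dd - 3) / 2 := by ring
    rw [e]; linarith
  -- the six bounds
  have t1 : (D.atScale γ lam).ν⁻¹ ≤ 2 * lam ^ (-γ) := by
    rw [eν, ← Real.rpow_neg hl0]; linarith [nn (-γ)]
  have t2 : (D.atScale γ lam).κ ^ (-(1 / 2 : ℝ)) * (D.atScale γ lam).σ *
      (D.atScale γ lam).μ ^ (aexp d + 1 - (dd - 1) / rOfGamma γ dd) ≤ 2 * lam ^ (-γ) := by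
    rw [eκ, eσ, eμ, pκ, her, ha, hk2']
    calc lam ^ (-(1 / γ + (dd + 1) / 2 - 3 * γ)) * (⌈lam ^ (1 / γ)⌉₊ : ℝ) * lam ^ ((dd - 1) / 2 + 1 - (dd - 1 - γ))
        ≤ lam ^ (-(1 / γ + (dd + 1) / 2 - 3 * γ)) * (2 * lam ^ (1 / γ)) * lam ^ ((dd - 1) / 2 + 1 - (dd - 1 - γ)) :=
          mul_le_mul_of_nonneg_right (mul_le_mul_of_nonneg_left hσle (nn _)) (nn _)
      _ = 2 * lam ^ (-(1 / γ + (dd + 1) / 2 - 3 * γ) + 1 / γ + ((dd - 1) / 2 + 1 - (dd - 1 - γ))) := by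
          rw [← pw, ← pw]; ring
      _ ≤ 2 * lam ^ (-γ) := by
          refine mul_le_mul_of_nonneg_left (mono ?_) zero_le_two
          nlinarith
  have t3 : (D.atScale γ lam).κ ^ (-(1 / 2 : ℝ)) * (D.atScale γ lam).μ ^ aexp d ≤ 2 * lam ^ (-γ) := by
    rw [eκ, eμ, pκ, ha, hk2', pw]
    have : lam ^ (-(1 / γ + (dd + 1) / 2 - 3 * γ) + (dd - 1) / 2) ≤ lam ^ (-γ) := mono (by nlinarith)
    linarith [nn (-(1 / γ + (dd + 1) / 2 - 3 * γ) + (dd - 1) / 2)]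
  have t4 : (D.atScale γ lam).ν * (D.atScale γ lam).κ ^ (1 / 2 : ℝ) * ((D.atScale γ lam).σ : ℝ)⁻¹ *
      (D.atScale γ lam).μ ^ (aexp d - 1 - (dd - 1) / rOfGamma γ dd) ≤ 2 * lam ^ (-γ) := by
    rw [eν, eκ, eσ, eμ, pκ, her, ha, hk2]
    calc lam ^ γ * lam ^ (1 / γ + (dd + 1) / 2 - 3 * γ) * ((⌈lam ^ (1 / γ)⌉₊ : ℕ) : ℝ)⁻¹ * lam ^ ((dd - 1) / 2 - 1 - (dd - 1 - γ))
        ≤ lam ^ γ * lam ^ (1 / γ + (dd + 1) / 2 - 3 * γ) * lam ^ (-(1 / γ)) * lam ^ ((dd - 1) / 2 - 1 - (dd - 1 - γ)) :=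
          mul_le_mul_of_nonneg_right (mul_le_mul_of_nonneg_left hσinv (mul_nonneg (nn _) (nn _))) (nn _)
      _ = lam ^ (γ + (1 / γ + (dd + 1) / 2 - 3 * γ) + -(1 / γ) + ((dd - 1) / 2 - 1 - (dd - 1 - γ))) := by rw [← pw, ← pw, ← pw]
      _ = lam ^ (-γ) := by congr 1; ring
      _ ≤ 2 * lam ^ (-γ) := by linarith [nn (-γ)]
  have t5 : (D.atScale γ lam).ν * (D.atScale γ lam).κ ^ (1 / 2 : ℝ) * (((D.atScale γ lam).σ : ℝ) ^ 2)⁻¹ *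
      (D.atScale γ lam).μ ^ (-2 : ℝ) ≤ 2 * lam ^ (-γ) := by
    rw [eν, eκ, eσ, eμ, pκ, hk2]
    calc lam ^ γ * lam ^ (1 / γ + (dd + 1) / 2 - 3 * γ) * ((((⌈lam ^ (1 / γ)⌉₊ : ℕ) : ℝ)) ^ 2)⁻¹ * lam ^ (-2 : ℝ)
        ≤ lam ^ γ * lam ^ (1 / γ + (dd + 1) / 2 - 3 * γ) * lam ^ (-(2 / γ)) * lam ^ (-2 : ℝ) :=
          mul_le_mul_of_nonneg_right (mul_le_mul_of_nonneg_left hσinv2 (mul_nonneg (nn _) (nn _))) (nn _)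
      _ = lam ^ (γ + (1 / γ + (dd + 1) / 2 - 3 * γ) + -(2 / γ) + (-2 : ℝ)) := by rw [← pw, ← pw, ← pw]
      _ ≤ lam ^ (-γ) := mono c5
      _ ≤ 2 * lam ^ (-γ) := by linarith [nn (-γ)]
  have t6 : ((D.atScale γ lam).σ : ℝ)⁻¹ * (D.atScale γ lam).μ ^ (2 * aexp d) ≤ 2 * lam ^ (-γ) := by
    rw [eσ, eμ, ha]
    calc ((⌈lam ^ (1 / γ)⌉₊ : ℕ) : ℝ)⁻¹ * lam ^ (2 * ((dd - 1) / 2)) ≤ lam ^ (-(1 / γ)) * lam ^ (2 * ((dd - 1) / 2)) :=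
          mul_le_mul_of_nonneg_right hσinv (nn _)
      _ = lam ^ (-(1 / γ) + 2 * ((dd - 1) / 2)) := pw _ _
      _ ≤ lam ^ (-γ) := mono (by nlinarith)
      _ ≤ 2 * lam ^ (-γ) := by linarith [nn (-γ)]
  unfold small
  simp only [hdd] at t1 t2 t3 t4 t5 t6 ⊢
  linarith

end Small

/-! ## The other parameter-dependent sizes -/

omit [Fintype d] [DecidableEq d] in
/-- `((T+1)κ^{q/2-1}A^q)^{1/q} ≤ (T+1) A κ^{1/2-1/q}` (`q ≥ 1`, `T, A ≥ 0`, `κ ≥ 1`). [folklore] -/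
theorem profile_rpow_le {T A κ q : ℝ} (hT : 0 ≤ T) (hA : 0 ≤ A) (hκ : 1 ≤ κ) (hq : 1 ≤ q) :
    ((T + 1) * κ ^ (q / 2 - 1) * A ^ q) ^ (1 / q) ≤ (T + 1) * A * κ ^ (1 / 2 - 1 / q) := by
  have hq0 : 0 < q := by linarith
  have hκ0 : 0 ≤ κ := by linarith
  have hAq : (A ^ q) ^ (1 / q) = A := by rw [one_div]; exact Real.rpow_rpow_inv hA hq0.ne'
  have hexp : (q / 2 - 1) * (1 / q) = 1 / 2 - 1 / q := by field_simp
  have e1 : ((T + 1) * κ ^ (q / 2 - 1) * A ^ q) ^ (1 / q) = (T + 1) ^ (1 / q) * κ ^ (1 / 2 - 1 / q) * A := by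
    rw [Real.mul_rpow (by positivity) (by positivity), Real.mul_rpow (by positivity) (by positivity),
      ← Real.rpow_mul hκ0, hAq, hexp]
  rw [e1]
  have h1 : (T + 1) ^ (1 / q) ≤ (T + 1) := by
    have := Real.rpow_le_rpow_of_exponent_le (by linarith : 1 ≤ T + 1) (by rw [div_le_one hq0]; exact hq : 1 / q ≤ 1)
    rwa [Real.rpow_one] at this
  calc (T + 1) ^ (1 / q) * κ ^ (1 / 2 - 1 / q) * A ≤ (T + 1) * κ ^ (1 / 2 - 1 / q) * A :=
        mul_le_mul_of_nonneg_right (mul_le_mul_of_nonneg_right h1 (Real.rpow_nonneg hκ0 _)) hA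
    _ = (T + 1) * A * κ ^ (1 / 2 - 1 / q) := by ring



end Datum

end CL22

end Literature.Analysis.FluidPDE


open Set Filter Topology Function MeasureTheory Finset
open scoped ContDiff ENNReal

namespace Literature.Analysis.FluidPDE

namespace Torus

open FunctionSpaces NashGeometric Mikado Intermittent CL22

variable {d : Type*} [Fintype d] [DecidableEq d]

/-- **Existence of a large scale meeting finitely many smallness requirements**: for `γ > 0`,
nonnegative constants `K₁,…,K₆` and positive targets `τ₁,…,τ₆` there is `λ ≥ 1` with
`Kᵢ λ^{-γ} ≤ τᵢ` for all `i` ("for `λ` sufficiently large", CL22 §5). [folklore] -/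
theorem exists_large_scale {γ : ℝ} (hγ : 0 < γ) (K₁ K₂ K₃ K₄ K₅ K₆ τ₁ τ₂ τ₃ τ₄ τ₅ τ₆ : ℝ)
    (h₁ : 0 < τ₁) (h₂ : 0 < τ₂) (h₃ : 0 < τ₃) (h₄ : 0 < τ₄) (h₅ : 0 < τ₅) (h₆ : 0 < τ₆) :
    ∃ lam : ℝ, 1 ≤ lam ∧ K₁ * lam ^ (-γ) ≤ τ₁ ∧ K₂ * lam ^ (-γ) ≤ τ₂ ∧ K₃ * lam ^ (-γ) ≤ τ₃ ∧
      K₄ * lam ^ (-γ) ≤ τ₄ ∧ K₅ * lam ^ (-γ) ≤ τ₅ ∧ K₆ * lam ^ (-γ) ≤ τ₆ := by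
  have h0 : Tendsto (fun lam : ℝ => lam ^ (-γ)) atTop (𝓝 0) := tendsto_rpow_neg_atTop hγ
  have hK : ∀ K τ : ℝ, 0 < τ → ∀ᶠ lam : ℝ in atTop, K * lam ^ (-γ) ≤ τ := by
    intro K τ hτ
    have h1 : Tendsto (fun lam : ℝ => K * lam ^ (-γ)) atTop (𝓝 0) := by simpa using h0.const_mul K
    exact (h1.eventually_lt_const hτ).mono fun _ h => h.le
  obtain ⟨lam, hlam⟩ := ((eventually_ge_atTop (1 : ℝ)).and ((hK K₁ τ₁ h₁).and ((hK K₂ τ₂ h₂).and ((hK K₃ τ₃ h₃).and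
    ((hK K₄ τ₄ h₄).and ((hK K₅ τ₅ h₅).and (hK K₆ τ₆ h₆))))))).exists
  exact ⟨lam, hlam.1, hlam.2.1, hlam.2.2.1, hlam.2.2.2.1, hlam.2.2.2.2.1, hlam.2.2.2.2.2.1, hlam.2.2.2.2.2.2⟩

set_option maxHeartbeats 1600000 in
/-- **Cheskidov–Luo 2022, Prop. 4.1 (the convex-integration step) — PROVED** for the rendering
`Torus.CheskidovLuo2022ConvexIntegration` of `NavierStokesReynoldsSteps` (every finite index type
`d` with `#d ≥ 2`, every `T > 0`, `0 < ε < 1`, `1 ≤ p < 2`). [cite: CheskidovLuo2022, Prop. 4.1] -/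
theorem CheskidovLuo2022ConvexIntegration_holds : CheskidovLuo2022ConvexIntegration (d := d) := by
  classical
  intro hd T hT ε hε hε1
  haveI : Nonempty d := Fintype.card_pos_iff.1 (by omega)
  -- dimension-dependent constants
  set dd : ℝ := (Fintype.card d : ℝ) with hdd
  set NN : ℝ := (Fintype.card (Index d) : ℝ) with hNN
  have hd2 : (2 : ℝ) ≤ dd := by rw [hdd]; exact_mod_cast hd
  have hrad : 0 < radius d := radius_pos hd
  set c₁ : ℝ := 2 * dd ^ 2 / radius d + dd with hc₁
  set c₂ : ℝ := 2 * dd / radius d with hc₂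
  have hc₁0 : 0 ≤ c₁ := by positivity
  have hc₂0 : 0 ≤ c₂ := by positivity
  set M : ℝ := Real.sqrt (c₁ + c₂ + 1) + 2 with hM
  have hM0 : 0 ≤ M := add_nonneg (Real.sqrt_nonneg _) zero_le_two
  refine ⟨M, by positivity, ?_⟩
  intro p hp1 hp2
  -- exponents
  have hp0 : 0 < p := by linarith
  set b : ℝ := 1 / p - 1 / 2 with hb
  have hb0 : 0 < b := by
    rw [hb, sub_pos, one_div_lt_one_div two_pos hp0]; exact hp2
  have hb2 : b ≤ 1 / 2 := by
    have : 1 / p ≤ 1 := by rw [div_le_one hp0]; exact hp1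
    rw [hb]; linarith
  set γ : ℝ := b / (2 * dd) with hγdef
  have hγ : 0 < γ := by positivity
  have hγd : γ ≤ 1 / (4 * dd) := by
    rw [hγdef, div_le_div_iff₀ (by positivity) (by positivity)]; nlinarith
  have hγ8 : γ ≤ 1 / 8 := by
    have : 1 / (4 * dd) ≤ 1 / 8 := by rw [div_le_div_iff₀ (by positivity) (by norm_num)]; linarith
    linarith
  have hγdm : γ < dd - 1 := by linarith
  have hγ2 : 2 * γ ≤ dd - 1 := by linarith
  set r : ℝ := rOfGamma γ dd with hrdef
  have hr1 : 1 < r := one_lt_rOfGamma hγ hγdm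
  have hr2 : r ≤ 2 := rOfGamma_le_two hγ hγ2
  refine ⟨r, hr1, ?_⟩
  intro δ hδ u P R I τ hNS hmean hwp hR32
  have hτ : 0 < τ := hwp.pos
  have hr1' : (1 : ℝ≥0∞) ≤ ENNReal.ofReal r := ENNReal.one_le_ofReal.2 hr1.le
  have hp1' : (1 : ℝ≥0∞) ≤ ENNReal.ofReal p := ENNReal.one_le_ofReal.2 hp1
  by_cases hR0 : ∀ t ∈ Icc 0 T, ∀ x, R t x = 0
  · -- `R ≡ 0`: the identity step
    have hzero : (fun t x => u t x - u t x) = fun _ _ => (0 : EuclideanSpace ℝ d) := by funext t x; simp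
    have hsm0 : ∀ {q : ℝ≥0∞} (_ : 1 ≤ q) (p' : ℝ≥0∞), eLqLpNorm q p' (fun t x => u t x - u t x) (Ioo 0 T) ≤ 0 := by
      intro q hq p'
      have := eLqLpNorm_le_of_forall_norm_le (T := T) (w := fun t x => u t x - u t x) le_rfl hq p' fun t _ x => by simp
      simpa using this
    refine ⟨u, P, R, hNS, hmean, hwp, ?_, fun t _ _ => rfl, ?_, ?_⟩
    · have := eLqLpNorm_le_of_forall_norm_le (T := T) (w := R) le_rfl le_rfl (ENNReal.ofReal r) fun t ht x => by
        rw [hR0 t (Ioo_subset_Icc_self ht) x, norm_zero]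
      exact this.trans (by simp)
    · exact (hsm0 one_le_two 2).trans bot_le
    · exact (hsm0 hp1' ⊤).trans bot_le
  -- `R ≢ 0`: the construction
  push Not at hR0
  -- the size of the old stress
  set NR : ℝ := ∫ t in (0 : ℝ)..T, ∫ y, ‖R t y‖ with hNRdef
  have hNR : eLqLpNorm 1 1 R (Ioo 0 T) = ENNReal.ofReal NR := eLqLpNorm_one_one_eq_ofReal_integral hNS.smooth_stress hT.le
  have hNR0 : 0 ≤ NR := intervalIntegral.integral_nonneg hT.le fun t _ => integral_nonneg fun _ => norm_nonneg _
  have hNRpos : 0 < NR := by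
    rcases hNR0.lt_or_eq with h | h
    · exact h
    · exfalso
      obtain ⟨t, ht, x, hx⟩ := hR0
      have h0 : eLqLpNorm 1 1 R (Ioo 0 T) = 0 := by rw [hNR, ← h, ENNReal.ofReal_zero]
      exact hx (eq_zero_of_eLqLpNorm_eq_zero hNS.smooth_stress hT one_ne_zero le_rfl h0 t ht x)
  -- the data of the construction
  obtain ⟨θ, hθs, hθ01, hθ0, hθ1, hθd0⟩ := CL22.exists_timeCutoff I hτ
  obtain ⟨g, hgb, hg1, hgg⟩ := Intermittent.exists_isBump_disjoint (Index d)
  set γ₀ : ℝ := NR / T with hγ₀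
  have hγ₀pos : 0 < γ₀ := div_pos hNRpos hT
  set D₀ : CL22.Datum d := ⟨T, γ₀, R, θ, g, 1, 1, 1, 1⟩ with hD₀
  have h₀ : D₀.Valid := ⟨hd, hT, hγ₀pos, hNS.smooth_stress, hNS.symm, hθs, hθ01, hgb, hg1, hgg, le_rfl, le_rfl, le_rfl, one_pos⟩
  obtain ⟨A, hA₀⟩ := CL22.Datum.exists_dataBounds h₀
  obtain ⟨C, hC0, hCu⟩ := CL22.Datum.exists_blockConsts (d := d)
  have hA0 := hA₀.nonneg
  obtain ⟨U', hU'⟩ := hNS.smooth_velocity.exists_norm_le_of_isCompact isCompact_Icc subset_rfl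
  set U : ℝ := max U' 0 with hU
  have hU0 : 0 ≤ U := le_max_right _ _
  have hUb : ∀ t ∈ Icc 0 T, ∀ y, ‖u t y‖ ≤ U := fun t ht y => (hU' t ht y).trans (le_max_left _ _)
  -- the family of data along the scale
  have hk0 : 0 ≤ kOfGamma γ dd := by
    rw [kOfGamma]; have : 0 < 2 / γ := by positivity
    nlinarith
  have hfam : ∀ lam : ℝ, 1 ≤ lam → (D₀.atScale γ lam).Valid := fun lam hlam =>
    h₀.withParams (Real.one_le_rpow hlam hγ.le) (Real.one_le_rpow hlam hk0) hlam (CL22.Datum.sigma_pos hlam)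
  have hAfam : ∀ lam : ℝ, (D₀.atScale γ lam).DataBounds A := fun lam => hA₀.withParams _ _ _ _
  -- the constants of the six smallness conditions
  set Cℛ : ℝ := antidivergenceL2Const d with hCℛ
  have hCℛ0 : 0 ≤ Cℛ := antidivergenceL2Const_nonneg
  set Kst : ℝ := CL22.Datum.stressConst A C U Cℛ T dd NN with hKst
  have hKst0 : 0 ≤ Kst := CL22.Datum.stressConst_nonneg hA0 hC0 hU0 hCℛ0 hT.le (by positivity) (by positivity)
  set K2 : ℝ := NN * (3 * A * C) * ((T + 1) * A) with hK2
  set K3 : ℝ := NN * (6 * A * (dd * C)) * ((T + 1) * A) with hK3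
  set K4 : ℝ := max 1 T * (NN * A) with hK4
  set K5 : ℝ := 5 * NN * ((2 * A ^ 2 + T * A) + A * C * (T + 1)) with hK5
  have hK20 : 0 ≤ K2 := by positivity
  have hK30 : 0 ≤ K3 := by positivity
  have hK40 : 0 ≤ K4 := by positivity
  have hK50 : 0 ≤ K5 := by positivity
  obtain ⟨lam, hlam, hx1, hx2, hx3, hx4, hx5, hx6⟩ := exists_large_scale hγ (12 * Kst) (K2 + K3 + K4) K5 K3 K4 0
    δ δ NR (Real.sqrt NR) (Real.sqrt NR) 1 hδ hδ hNRpos (Real.sqrt_pos.2 hNRpos) (Real.sqrt_pos.2 hNRpos) one_pos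
  set x : ℝ := lam ^ (-γ) with hxdef
  have hl0 : 0 < lam := lt_of_lt_of_le one_pos hlam
  have hx0 : 0 ≤ x := Real.rpow_nonneg hl0.le _
  -- the datum
  set E : CL22.Datum d := D₀.atScale γ lam with hE
  have hEv : E.Valid := hfam lam hlam
  have hAE : E.DataBounds A := hAfam lam
  have hCE : E.BlockConsts C := hCu E hEv
  have eT : E.T = T := rfl
  have eR : E.R = R := rfl
  have eθ : E.θ = θ := rfl
  have eγ₀ : E.γ₀ = γ₀ := rfl
  have eν : E.ν = lam ^ γ := rfl
  have eκ : E.κ = lam ^ kOfGamma γ dd := rfl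
  have eμ : E.μ = lam := rfl
  have eσ : E.σ = ⌈lam ^ (1 / γ)⌉₊ := rfl
  have hκ1 : 1 ≤ E.κ := by rw [eκ]; exact Real.one_le_rpow hlam hk0
  have hσ1 : (1 : ℝ) ≤ E.σ := by rw [eσ]; exact_mod_cast CL22.Datum.sigma_pos hlam
  -- parameter bookkeeping: the four small factors
  have hνinv : E.ν⁻¹ = x := by rw [eν, hxdef, Real.rpow_neg hl0.le]
  have hsmall : E.small r ≤ 12 * x := by
    have := CL22.Datum.small_atScale_le h₀ hγ (by rwa [hdd] at hγd) hlam
    simpa [hrdef, hdd] using this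
  have ha : aexp d = (dd - 1) / 2 := by rw [aexp]
  have pw : ∀ a c : ℝ, lam ^ a * lam ^ c = lam ^ (a + c) := fun a c => (Real.rpow_add hl0 a c).symm
  have mono : ∀ {a c : ℝ}, a ≤ c → lam ^ a ≤ lam ^ c := fun hac => Real.rpow_le_rpow_of_exponent_le hlam hac
  have nn : ∀ a : ℝ, 0 ≤ lam ^ a := fun a => Real.rpow_nonneg hl0.le a
  have hig : 4 * dd ≤ 1 / γ := by
    rw [le_div_iff₀ hγ]; rw [le_div_iff₀ (by positivity)] at hγd; linarith
  -- `μ^a κ^{1/2-1/p} ≤ x` (CL22 (5.3))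
  have hQ2 : E.μ ^ aexp d * E.κ ^ (1 / 2 - 1 / p) ≤ x := by
    rw [eμ, eκ, ← Real.rpow_mul hl0.le, pw, hxdef, ha]
    refine mono ?_
    have e1 : 1 / 2 - 1 / p = -b := by rw [hb]; ring
    rw [e1, kOfGamma]
    have e2 : (2 / γ + dd + 1 - 6 * γ) * -b = -(2 * b / γ) - b * (dd + 1) + 6 * b * γ := by ring
    have e3 : 2 * b / γ = 4 * dd := by
      rw [hγdef]; field_simp; norm_num
    rw [e2, e3]
    have h6 : 6 * b * γ ≤ 3 * γ := by nlinarith only [hb2, hγ]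
    have h7 : 0 ≤ b * (dd + 1) := by positivity
    linarith only [h6, h7, hd2, hγ8]
  -- `σ⁻¹ μ^{a-1} ≤ x`
  have hQ3 : (E.σ : ℝ)⁻¹ * E.μ ^ (aexp d - 1) ≤ x := by
    rw [eσ, eμ, hxdef, ha]
    calc ((⌈lam ^ (1 / γ)⌉₊ : ℕ) : ℝ)⁻¹ * lam ^ ((dd - 1) / 2 - 1) ≤ lam ^ (-(1 / γ)) * lam ^ ((dd - 1) / 2 - 1) :=
          mul_le_mul_of_nonneg_right (CL22.Datum.inv_sigma_le hlam) (nn _)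
      _ = lam ^ (-(1 / γ) + ((dd - 1) / 2 - 1)) := pw _ _
      _ ≤ lam ^ (-γ) := mono (by linarith only [hig, hd2, hγ8, hγ])
  -- `σ⁻² μ^a ≤ x`
  have hQ5 : ((E.σ : ℝ) ^ 2)⁻¹ * E.μ ^ aexp d ≤ x := by
    rw [eσ, eμ, hxdef, ha]
    calc (((⌈lam ^ (1 / γ)⌉₊ : ℕ) : ℝ) ^ 2)⁻¹ * lam ^ ((dd - 1) / 2) ≤ lam ^ (-(2 / γ)) * lam ^ ((dd - 1) / 2) :=
          mul_le_mul_of_nonneg_right (CL22.Datum.inv_sigma_sq_le hlam) (nn _)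
      _ = lam ^ (-(2 / γ) + (dd - 1) / 2) := pw _ _
      _ ≤ lam ^ (-γ) := mono (by
          have e2 : (2 : ℝ) / γ = 2 * (1 / γ) := by ring
          rw [e2]; linarith only [hig, hd2, hγ8, hγ])
  -- the explicit objects
  set w := E.w with hw
  set R₁ := perturbedStress u E.w E.S₁ E.ff with hR₁
  have hRθ : ∀ s ∈ Icc 0 E.T, E.θ s ≠ 1 → ∀ y, E.R s y = 0 := by
    intro s hs hne y
    have hlt : Metric.infDist s Iᶜ < 3 * τ / 2 := by
      by_contra hge; exact hne (hθ1 s (not_lt.1 hge))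
    exact hR32 s hs hlt.le y
  have hNS₁ : IsNSReynoldsOn (Icc 0 T) 1 (fun t y => u t y + E.w t y) (perturbedPressure u E.w P E.qq E.S₁) R₁ :=
    hNS.perturb hd hT (CL22.Datum.smooth_w hEv) (fun t ht => CL22.Datum.isDivFree_w hEv ht)
      (fun t ht => CL22.Datum.hasZeroMean_w hEv ht) (CL22.Datum.smooth_S₁ hEv)
      (fun t _ y i j => CL22.Datum.S₁_symm hEv t y i j) (CL22.Datum.smooth_qq hEv) (CL22.Datum.smooth_ff hEv)
      (fun t ht y => CL22.Datum.momentum_identity hEv hRθ ht y)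
  -- the three mixed-norm bounds along the family
  have hstress : eLqLpNorm 1 (ENNReal.ofReal r) R₁ (Ioo 0 T) ≤ ENNReal.ofReal δ := by
    refine (CL22.Datum.eLqLpNorm_one_perturbedStress_le hEv hAE hCE hU0 hUb hr1.le hr2).trans (ENNReal.ofReal_le_ofReal ?_)
    calc CL22.Datum.stressConst A C U (antidivergenceL2Const d) E.T (Fintype.card d) (Fintype.card (Index d)) * E.small r
        = Kst * E.small r := by rw [hKst, hCℛ, hdd, hNN, eT]
      _ ≤ Kst * (12 * x) := mul_le_mul_of_nonneg_left hsmall hKst0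
      _ = 12 * Kst * x := by ring
      _ ≤ δ := hx1
  have hwp_top : eLqLpNorm (ENNReal.ofReal p) ⊤ E.wp (Ioo 0 T) ≤ ENNReal.ofReal (K2 * x) := by
    refine (CL22.Datum.eLqLpNorm_wp_top_le hEv hAE hCE hp1).trans (ENNReal.ofReal_le_ofReal ?_)
    have h1 := CL22.Datum.profile_rpow_le (κ := E.κ) hT.le hA0 hκ1 hp1
    calc (Fintype.card (Index d) : ℝ) * (3 * A * C * E.μ ^ aexp d) * ((E.T + 1) * E.κ ^ (p / 2 - 1) * A ^ p) ^ (1 / p)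
        ≤ NN * (3 * A * C * E.μ ^ aexp d) * ((T + 1) * A * E.κ ^ (1 / 2 - 1 / p)) :=
          mul_le_mul_of_nonneg_left h1 (by rw [eμ]; positivity)
      _ = NN * (3 * A * C) * ((T + 1) * A) * (E.μ ^ aexp d * E.κ ^ (1 / 2 - 1 / p)) := by ring
      _ ≤ NN * (3 * A * C) * ((T + 1) * A) * x := mul_le_mul_of_nonneg_left hQ2 (by positivity)
      _ = K2 * x := by rw [hK2]
  have hwc_top : ∀ {q : ℝ}, 1 ≤ q → q ≤ 2 → eLqLpNorm (ENNReal.ofReal q) ⊤ E.wc (Ioo 0 T) ≤ ENNReal.ofReal (K3 * x) := by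
    intro q hq hq2
    refine (CL22.Datum.eLqLpNorm_wc_top_le hEv hAE hCE hq).trans (ENNReal.ofReal_le_ofReal ?_)
    have h1 := CL22.Datum.profile_rpow_le (κ := E.κ) hT.le hA0 hκ1 hq
    have hq0 : 0 < q := by linarith only [hq]
    have hκs : E.κ ^ (1 / 2 - 1 / q) ≤ 1 := by
      refine Real.rpow_le_one_of_one_le_of_nonpos hκ1 ?_
      have : 1 / 2 ≤ 1 / q := by rw [div_le_div_iff₀ two_pos hq0]; linarith only [hq2]
      linarith only [this]
    calc (Fintype.card (Index d) : ℝ) * (6 * A * (Fintype.card d * (C * (E.σ : ℝ)⁻¹ * E.μ ^ (aexp d - 1)))) *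
          ((E.T + 1) * E.κ ^ (q / 2 - 1) * A ^ q) ^ (1 / q)
        ≤ NN * (6 * A * (dd * (C * (E.σ : ℝ)⁻¹ * E.μ ^ (aexp d - 1)))) * ((T + 1) * A * E.κ ^ (1 / 2 - 1 / q)) :=
          mul_le_mul_of_nonneg_left h1 (by rw [eμ]; positivity)
      _ = NN * (6 * A * (dd * C)) * ((T + 1) * A) * (((E.σ : ℝ)⁻¹ * E.μ ^ (aexp d - 1)) * E.κ ^ (1 / 2 - 1 / q)) := by ring
      _ ≤ NN * (6 * A * (dd * C)) * ((T + 1) * A) * (x * 1) := by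
          refine mul_le_mul_of_nonneg_left ?_ (by positivity)
          exact mul_le_mul hQ3 hκs (Real.rpow_nonneg (zero_le_one.trans hκ1) _) hx0
      _ = K3 * x := by rw [hK3]; ring
  have hwt_le : ∀ {q : ℝ≥0∞} (_ : 1 ≤ q) (s : ℝ≥0∞), eLqLpNorm q s E.wt (Ioo 0 T) ≤ ENNReal.ofReal (K4 * x) := by
    intro q hq s
    refine (CL22.Datum.eLqLpNorm_wt_le hEv hAE hq s).trans (le_of_eq ?_)
    rw [hK4, hνinv, eT]
    congr 1
    ring
  have hwp_two : eLqLpNorm 2 2 E.wp (Ioo 0 T) ≤ ENNReal.ofReal (Real.sqrt ((c₁ + c₂ + 1) * NR)) := by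
    refine (CL22.Datum.eLqLpNorm_two_wp_le hEv hAE hCE).trans (ENNReal.ofReal_le_ofReal (Real.sqrt_le_sqrt ?_))
    rw [eR, eT, eγ₀, hνinv]
    have e1 : 2 * (Fintype.card d : ℝ) / radius d * γ₀ * T = c₂ * NR := by
      rw [hc₂, hγ₀, hdd]; field_simp
    have herr : ((E.σ : ℝ) ^ 2)⁻¹ * A * (C * E.μ ^ aexp d) * (T + 1) ≤ A * C * (T + 1) * x := by
      calc ((E.σ : ℝ) ^ 2)⁻¹ * A * (C * E.μ ^ aexp d) * (T + 1) = A * C * (T + 1) * (((E.σ : ℝ) ^ 2)⁻¹ * E.μ ^ aexp d) := by ring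
        _ ≤ A * C * (T + 1) * x := mul_le_mul_of_nonneg_left hQ5 (mul_nonneg (mul_nonneg hA0 hC0) (add_nonneg hT.le zero_le_one))
    have h5 : 5 * (Fintype.card (Index d) : ℝ) * (x * (2 * A ^ 2 + T * A) + ((E.σ : ℝ) ^ 2)⁻¹ * A * (C * E.μ ^ aexp d) * (T + 1)) ≤ K5 * x := by
      rw [hK5]
      have : x * (2 * A ^ 2 + T * A) + ((E.σ : ℝ) ^ 2)⁻¹ * A * (C * E.μ ^ aexp d) * (T + 1) ≤ ((2 * A ^ 2 + T * A) + A * C * (T + 1)) * x := by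
        linarith only [herr]
      calc 5 * (Fintype.card (Index d) : ℝ) * (x * (2 * A ^ 2 + T * A) + ((E.σ : ℝ) ^ 2)⁻¹ * A * (C * E.μ ^ aexp d) * (T + 1))
          ≤ 5 * (Fintype.card (Index d) : ℝ) * (((2 * A ^ 2 + T * A) + A * C * (T + 1)) * x) :=
            mul_le_mul_of_nonneg_left this (mul_nonneg (by norm_num) (Nat.cast_nonneg _))
        _ = 5 * NN * ((2 * A ^ 2 + T * A) + A * C * (T + 1)) * x := by rw [hNN]; ring
    have hc₁' : (2 * (Fintype.card d : ℝ) ^ 2 / radius d + Fintype.card d) * NR = c₁ * NR := by rw [hc₁, hdd]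
    rw [hc₁', e1]
    calc c₁ * NR + c₂ * NR + 5 * (Fintype.card (Index d) : ℝ) * (x * (2 * A ^ 2 + T * A) +
          ((E.σ : ℝ) ^ 2)⁻¹ * A * (C * E.μ ^ aexp d) * (T + 1))
        ≤ c₁ * NR + c₂ * NR + K5 * x := by linarith only [h5]
      _ ≤ c₁ * NR + c₂ * NR + NR := by linarith only [hx3]
      _ = (c₁ + c₂ + 1) * NR := by ring
  have hwc_two : eLqLpNorm 2 2 E.wc (Ioo 0 T) ≤ ENNReal.ofReal (K3 * x) := by
    refine (eLqLpNorm_mono_exponent_of_smooth (CL22.Datum.smooth_wc hEv) 2 le_top).trans ?_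
    have := hwc_top (q := 2) one_le_two le_rfl
    rwa [ENNReal.ofReal_ofNat] at this
  have hwt_two : eLqLpNorm 2 2 E.wt (Ioo 0 T) ≤ ENNReal.ofReal (K4 * x) := hwt_le one_le_two 2
  -- the perturbation as the increment
  have hsub : (fun t y => (u t y + E.w t y) - u t y) = fun t y => (E.wp t y + E.wc t y) + E.wt t y := by
    funext t y; simp [CL22.Datum.w]
  have s1 := CL22.Datum.smooth_wp hEv
  have s2 := CL22.Datum.smooth_wc hEv
  have s3 := CL22.Datum.smooth_wt hEv
  have s12 : FunctionSpaces.Torus.IsSmoothSpaceTimeOn (Icc 0 T) (fun t y => E.wp t y + E.wc t y) := s1.add s2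
  -- conclusion
  refine ⟨fun t y => u t y + E.w t y, perturbedPressure u E.w P E.qq E.S₁, R₁, hNS₁, ?_, ?_, hstress, ?_, ?_, ?_⟩
  · -- zero mean
    intro t ht
    have hu0 : ∫ y, u t y = 0 := hmean t ht
    have hw0 : ∫ y, E.w t y = 0 := CL22.Datum.hasZeroMean_w hEv ht
    show ∫ y, (u t y + E.w t y) = 0
    rw [integral_add (hNS.smooth_velocity.isSmooth_slice ht).integrable ((CL22.Datum.smooth_w hEv).isSmooth_slice ht).integrable,
      hu0, hw0, add_zero]
  · -- well-preparedness for the same `(I, τ)` (Lemma 4.6)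
    refine ⟨hτ, hwp.exists_finset, fun t ht hdist y => ?_⟩
    have hθt : E.θ t = 0 := hθ0 t hdist
    have hθ't : deriv E.θ t = 0 := hθd0 t hdist
    exact perturbedStress_eq_zero (fun y => CL22.Datum.w_eq_zero hθt y) (fun y => CL22.Datum.S₁_eq_zero hθt y)
      (fun y => CL22.Datum.ff_eq_zero hEv ht hθt hθ't y) y
  · -- support in `I`
    intro t ht htI
    have hθt : E.θ t = 0 := hθ0 t (by rw [Metric.infDist_zero_of_mem (mem_compl htI)]; exact hτ.le)
    funext y
    simp [CL22.Datum.w_eq_zero hθt]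
  · -- the energy bound
    rw [hsub]
    have hsum : eLqLpNorm 2 2 (fun t y => E.wp t y + E.wc t y + E.wt t y) (Ioo 0 T) ≤
        ENNReal.ofReal (Real.sqrt ((c₁ + c₂ + 1) * NR)) + ENNReal.ofReal (Real.sqrt NR) + ENNReal.ofReal (Real.sqrt NR) :=
      calc eLqLpNorm 2 2 (fun t y => E.wp t y + E.wc t y + E.wt t y) (Ioo 0 T)
          ≤ eLqLpNorm 2 2 (fun t y => E.wp t y + E.wc t y) (Ioo 0 T) + eLqLpNorm 2 2 E.wt (Ioo 0 T) :=
            eLqLpNorm_add_le_of_smooth s12 s3 one_le_two one_le_two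
        _ ≤ eLqLpNorm 2 2 E.wp (Ioo 0 T) + eLqLpNorm 2 2 E.wc (Ioo 0 T) + eLqLpNorm 2 2 E.wt (Ioo 0 T) :=
            add_le_add (eLqLpNorm_add_le_of_smooth s1 s2 one_le_two one_le_two) le_rfl
        _ ≤ ENNReal.ofReal (Real.sqrt ((c₁ + c₂ + 1) * NR)) + ENNReal.ofReal (K3 * x) + ENNReal.ofReal (K4 * x) :=
            add_le_add (add_le_add hwp_two hwc_two) hwt_two
        _ ≤ _ := add_le_add (add_le_add le_rfl (ENNReal.ofReal_le_ofReal hx4)) (ENNReal.ofReal_le_ofReal hx5)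
    refine hsum.trans (le_of_eq ?_)
    have hs0 : 0 ≤ Real.sqrt NR := Real.sqrt_nonneg _
    rw [← ENNReal.ofReal_add (Real.sqrt_nonneg _) hs0, ← ENNReal.ofReal_add (add_nonneg (Real.sqrt_nonneg _) hs0) hs0, hNR,
      ENNReal.ofReal_rpow_of_nonneg hNR0 (by norm_num), ← Real.sqrt_eq_rpow, ← ENNReal.ofReal_mul hM0]
    congr 1
    rw [hM, Real.sqrt_mul (add_nonneg (add_nonneg hc₁0 hc₂0) zero_le_one)]
    ring
  · -- the `L^p_t L^∞_x` bound
    rw [hsub]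
    calc eLqLpNorm (ENNReal.ofReal p) ⊤ (fun t y => E.wp t y + E.wc t y + E.wt t y) (Ioo 0 T)
        ≤ eLqLpNorm (ENNReal.ofReal p) ⊤ (fun t y => E.wp t y + E.wc t y) (Ioo 0 T) + eLqLpNorm (ENNReal.ofReal p) ⊤ E.wt (Ioo 0 T) :=
          eLqLpNorm_add_le_of_smooth s12 s3 hp1' le_top
      _ ≤ eLqLpNorm (ENNReal.ofReal p) ⊤ E.wp (Ioo 0 T) + eLqLpNorm (ENNReal.ofReal p) ⊤ E.wc (Ioo 0 T) +
            eLqLpNorm (ENNReal.ofReal p) ⊤ E.wt (Ioo 0 T) :=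
          add_le_add (eLqLpNorm_add_le_of_smooth s1 s2 hp1' le_top) le_rfl
      _ ≤ ENNReal.ofReal (K2 * x) + ENNReal.ofReal (K3 * x) + ENNReal.ofReal (K4 * x) :=
          add_le_add (add_le_add hwp_top (hwc_top hp1 hp2.le)) (hwt_le hp1' ⊤)
      _ = ENNReal.ofReal ((K2 + K3 + K4) * x) := by
          rw [← ENNReal.ofReal_add (mul_nonneg hK20 hx0) (mul_nonneg hK30 hx0),
            ← ENNReal.ofReal_add (add_nonneg (mul_nonneg hK20 hx0) (mul_nonneg hK30 hx0)) (mul_nonneg hK40 hx0)]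
          ring_nf
      _ ≤ ENNReal.ofReal δ := ENNReal.ofReal_le_ofReal hx2

end Torus

end Literature.Analysis.FluidPDE
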